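import Mathlib
import Literature.NumberTheory.QuadraticForms.HasseMinkowskiNumberField
import HarnessLib

/-!
# Landherr's theorem for hermitian planes over a CM field (sufficiency of the invariants)

Topic `NumberTheory/QuadraticForms`; theorems only (no definition, no named fact, no instance).

Let `K` be a CM field (Mathlib `NumberField.IsCMField K`) with complex conjugation
`σ = IsCMField.complexConj K` and maximal real subfield `K⁺ = maximalRealSubfield K`, so that
`K/K⁺` is a quadratic extension with non-trivial automorphism `σ` and `N(z) = z · σ z` is the
relative norm. **Landherr's theorem** (W. Landherr, *Äquivalenz Hermitescher Formen über einem
beliebigen algebraischen Zahlkörper*, Abh. Math. Sem. Hamburg **11** (1936) 245–248; restated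
with proof in Scharlau, *Quadratic and Hermitian Forms*, Ch. 10; quoted as Deligne, *Hodge cycles
on abelian varieties*, LNM 900 (1982), Prop. 4.1, and Cattani et al. (eds.), *Hodge Theory*,
Math. Notes 49, Thm. 11.5.13): non-degenerate `σ`-hermitian forms over `K` are classified by
their rank, their discriminant in `K⁺ˣ / N(Kˣ)` and their signatures at the complex embeddings.

This file proves the **rank-2, sufficiency** half in coordinates
(`hermitianPlanes_isometric_of_invariants`): two diagonal hermitian planes `⟨a₀, a₁⟩`, `⟨a₂, a₃⟩`
(`aᵢ ∈ K⁺`, `aᵢ ≠ 0`) with the same signs at every complex embedding `τ : K →+* ℂ` (equal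
signatures — `τ aᵢ` is real since `σ aᵢ = aᵢ`) and `a₀a₁ = a₂a₃ N(z)` for some `z ≠ 0` (equal
discriminant classes) are isometric: `ᵗ(σ g) · diag(a₀, a₁) · g = diag(a₂, a₃)` for some
`g ∈ GL₂(K)`. The necessity of the invariants and the resulting `iff` are in
`LandherrHermitianPlanesIff.lean`.

## Proof (Jacobson's reduction of hermitian to quadratic forms; O'Meara §66 footnote p. 186, Scharlau Ch. 10 §1)

Pick `θ ≠ 0` with `σ θ = -θ` (`Landherr.exists_skew`), so `K = K⁺ ⊕ K⁺θ`, `d := θ² ∈ K⁺` is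
negative at every real embedding of `K⁺`, and `N(u + vθ) = u² - d v²` for `u, v ∈ K⁺`.
1. (`Landherr.exists_rep_of_signs`) The quinary form `a₀(X₀² - dX₁²) + a₁(X₂² - dX₃²) - a₂X₄²`
   over `K⁺` has non-zero coefficients and is indefinite at every real embedding `ρ` of `K⁺`:
   extend `ρ` to `τ : K →+* ℂ` (`Landherr.exists_embedding_extending`, `IsAlgClosed.lift`), so
   `ρ(aᵢ) = Re τ(aᵢ)`, and the signature hypothesis at `τ` says the sign of `a₂` occurs among the
   signs of `a₀, a₁`. By the **Hasse–Minkowski theorem** in the quinary isotropy form over the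
   number field `K⁺` (tree theorem
   `Literature.NumberTheory.QuadraticForms.diagIsotropic_of_five_le_of_indefinite`, O'Meara 66:1
   with 63:19 — proved in the tree) it has a non-trivial zero, which gives `p, q ∈ K` with
   `a₀ N(p) + a₁ N(q) = a₂` (if `X₄ = 0` the plane `⟨a₀, a₁⟩` is isotropic, hence universal:
   `p = P(1+m)`, `q = Q(1-m)`, `m = a₂ / (4 a₀ N(P))`).
2. (`Landherr.isometry_of_rep`) With `a₀a₁ = a₂a₃ N(z)` and `w := (a₂ z)⁻¹`, the matrix
   `g = [[p, a₁ σ(q) w], [q, -a₀ σ(p) w]]` has `det g = -a₂ w ≠ 0` and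
   `ᵗ(σ g) · diag(a₀, a₁) · g = diag(a₂, a₀a₁a₂ N(w)) = diag(a₂, a₃)` — pure algebra.

The only arithmetic input is the Hasse–Minkowski theorem over `K⁺` (step 1); everything else is
`σ`-linear algebra. No named fact is consumed.

Provenance: written for the `pub-hodgecm` reproduction of the arithmetic inputs of Deligne's
"Hodge cycles on abelian varieties" §4–5, where this is the classification step of the proof that
the Weil classes are Hodge classes (LNM 900 Prop. 4.1, rank-2 planes `W₁ ⊕ W₂ ≅ W₃ ⊕ W₄`); ported
to Mathlib vocabulary (`IsCMField.complexConj`) from that package's `LandherrClassification.lean`.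

## References

* W. Landherr, Abh. Math. Sem. Univ. Hamburg 11 (1936) 245–248 [Landherr1936HermitianForms].
* W. Scharlau, *Quadratic and Hermitian Forms*, Grundlehren 270 (1985), Ch. 10
  [Scharlau1985HermitianForms].
* O. T. O'Meara, *Introduction to Quadratic Forms* (1963), §66, 66:1 and footnote p. 186
  [Omeara1963].
* P. Deligne, *Hodge cycles on abelian varieties*, LNM 900 (1982), §4 Prop. 4.1
  [Deligne1982HodgeCycles].
-/

noncomputable section

open NumberField
open scoped Matrix ComplexConjugate

namespace Literature.NumberTheory.QuadraticForms

namespace Landherr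

variable (K : Type) [Field K] [NumberField K] [IsCMField K]

/-- A CM field has a non-zero purely imaginary element: `θ ≠ 0`, `σ θ = -θ` (take `x - σ x` for
any `x ∉ K⁺`). [folklore] -/
theorem exists_skew : ∃ θ : K, θ ≠ 0 ∧ IsCMField.complexConj K θ = -θ := by
  obtain ⟨x, hx⟩ : ∃ x : K, IsCMField.complexConj K x ≠ x := by
    by_contra! h
    exact IsCMField.complexConj_ne_one K (AlgEquiv.ext fun y => by simpa using h y)
  refine ⟨x - IsCMField.complexConj K x, sub_ne_zero.mpr (fun h => hx h.symm), ?_⟩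
  rw [map_sub, IsCMField.complexConj_apply_apply]
  ring

variable {K} in
/-- `1, θ` are `K⁺`-linearly independent for `θ ≠ 0` skew: `u + vθ = 0` with `u, v` fixed by `σ`
forces `u = v = 0`. [folklore] -/
theorem eq_zero_of_add_mul_skew {θ u v : K} (hθ0 : θ ≠ 0) (hθ : IsCMField.complexConj K θ = -θ)
    (hu : IsCMField.complexConj K u = u) (hv : IsCMField.complexConj K v = v)
    (h : u + v * θ = 0) : u = 0 ∧ v = 0 := by
  have h' : u - v * θ = 0 := by
    have h2 := congrArg (IsCMField.complexConj K) h
    rw [map_add, map_mul, hu, hv, hθ, map_zero] at h2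
    linear_combination h2
  have hu0 : u = 0 := by
    have h3 : (2 : K) * u = 0 := by linear_combination h + h'
    exact (mul_eq_zero.mp h3).resolve_left two_ne_zero
  refine ⟨hu0, ?_⟩
  have h4 : v * θ = 0 := by linear_combination h - hu0
  exact (mul_eq_zero.mp h4).resolve_right hθ0

omit [IsCMField K] in
/-- Every real embedding `ρ` of the maximal real subfield `K⁺` is the restriction of a complex
embedding `τ` of `K` (extend `K⁺ → ℝ ⊂ ℂ` to the algebraic extension `K/K⁺`, `IsAlgClosed.lift`).
[folklore] -/
theorem exists_embedding_extending (ρ : maximalRealSubfield K →+* ℝ) :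
    ∃ τ : K →+* ℂ, ∀ y : maximalRealSubfield K, τ y = ((ρ y : ℝ) : ℂ) := by
  letI : Algebra (maximalRealSubfield K) ℂ := ((algebraMap ℝ ℂ).comp ρ).toAlgebra
  haveI : Algebra.IsAlgebraic (maximalRealSubfield K) K :=
    Algebra.IsAlgebraic.tower_top (K := ℚ) (maximalRealSubfield K)
  haveI : Module.IsTorsionFree (maximalRealSubfield K) ℂ := DivisionSemiring.to_moduleIsTorsionFree
  haveI : Module.IsTorsionFree (maximalRealSubfield K) K := DivisionSemiring.to_moduleIsTorsionFree
  let τ : K →ₐ[maximalRealSubfield K] ℂ := IsAlgClosed.lift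
  exact ⟨τ.toRingHom, fun y => τ.commutes y⟩

/-- **Step 1 (representation, from Hasse–Minkowski over `K⁺`).** If `a₀, a₁, a₂, a₃ ∈ K⁺ˣ` and at
every complex embedding the sign multisets `{sgn a₀, sgn a₁}` and `{sgn a₂, sgn a₃}` agree (so the
sign of `a₂` occurs among the signs of `a₀, a₁`), then the hermitian plane `⟨a₀, a₁⟩` represents
`a₂`: `a₀ N(p) + a₁ N(q) = a₂` for some `p, q ∈ K`. The arithmetic input is the quinary isotropy
form of the Hasse–Minkowski theorem over the number field `K⁺`
(`diagIsotropic_of_five_le_of_indefinite`, O'Meara 66:1 + 63:19), applied to Jacobson's quadratic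
form `a₀(X₀² - θ²X₁²) + a₁(X₂² - θ²X₃²) - a₂X₄²`. [cite: Landherr1936HermitianForms] -/
theorem exists_rep_of_signs (a : Fin 4 → K) (ha : ∀ i, IsCMField.complexConj K (a i) = a i)
    (ha0 : ∀ i, a i ≠ 0)
    (hsig : ∀ τ : K →+* ℂ,
      ({decide (0 < (τ (a 0)).re), decide (0 < (τ (a 1)).re)} : Multiset Bool) =
        {decide (0 < (τ (a 2)).re), decide (0 < (τ (a 3)).re)}) :
    ∃ p q : K, a 0 * (p * IsCMField.complexConj K p) + a 1 * (q * IsCMField.complexConj K q) =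
      a 2 := by
  obtain ⟨θ, hθ0, hθ⟩ := exists_skew K
  have hθ2 : IsCMField.complexConj K (θ ^ 2) = θ ^ 2 := by rw [map_pow, hθ, neg_sq]
  -- the coefficients of the quinary form over `F = K⁺`
  have hfix : ∀ y : maximalRealSubfield K, IsCMField.complexConj K y = y :=
    IsCMField.complexConj_apply_eq_self K
  let A : Fin 4 → maximalRealSubfield K :=
    fun i => ⟨a i, (IsCMField.complexConj_eq_self_iff K _).mp (ha i)⟩
  let D : maximalRealSubfield K := ⟨θ ^ 2, (IsCMField.complexConj_eq_self_iff K _).mp hθ2⟩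
  let c : Fin 5 → maximalRealSubfield K := ![A 0, -(D * A 0), A 1, -(D * A 1), -(A 2)]
  have hA0 : ∀ i, A i ≠ 0 := fun i h => ha0 i (by simpa [A] using congrArg Subtype.val h)
  have hD0 : D ≠ 0 := fun h => pow_ne_zero 2 hθ0 (by simpa [D] using congrArg Subtype.val h)
  have hc0 : ∀ i, c i ≠ 0 := by
    intro i
    fin_cases i <;> simp [c, hA0, hD0]
  -- indefinite at every real embedding of `K⁺`
  have hsgn : ∀ ρ : maximalRealSubfield K →+* ℝ, ∃ i j, ρ (c i) < 0 ∧ 0 < ρ (c j) := by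
    intro ρ
    obtain ⟨τ, hτ⟩ := exists_embedding_extending K ρ
    have hre : ∀ i, (τ (a i)).re = ρ (A i) := fun i => by
      rw [show a i = ((A i : maximalRealSubfield K) : K) from rfl, hτ]; simp
    have hρA : ∀ i, ρ (A i) ≠ 0 := fun i => (map_ne_zero ρ).mpr (hA0 i)
    -- `d = θ²` is negative at `ρ`
    have hDneg : ρ D < 0 := by
      have h1 : τ (IsCMField.complexConj K θ) = conj (τ θ) :=
        IsCMField.complexEmbedding_complexConj K τ θ
      rw [hθ, map_neg] at h1
      have hre0 : (τ θ).re = 0 := by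
        have h1' := congrArg Complex.re h1
        simp only [Complex.neg_re, Complex.conj_re] at h1'
        linarith
      obtain ⟨s, hs⟩ : ∃ s : ℝ, τ θ = (s : ℂ) * Complex.I :=
        ⟨(τ θ).im, by apply Complex.ext <;> simp [hre0]⟩
      have hs0 : s ≠ 0 := by
        rintro rfl
        exact hθ0 ((map_eq_zero τ).mp (by simpa using hs))
      have h2 : ((ρ D : ℝ) : ℂ) = ((-(s ^ 2) : ℝ) : ℂ) := by
        rw [← hτ D]
        show τ (θ ^ 2) = _
        rw [map_pow, hs, mul_pow, Complex.I_sq]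
        push_cast
        ring
      have h3 : ρ D = -(s ^ 2) := by exact_mod_cast h2
      rw [h3]
      exact neg_lt_zero.mpr (sq_pos_iff.mpr hs0)
    -- the sign of `a₂` occurs among the signs of `a₀, a₁` at `τ`
    have h2mem : decide (0 < (τ (a 2)).re) ∈
        ({decide (0 < (τ (a 0)).re), decide (0 < (τ (a 1)).re)} : Multiset Bool) := by
      rw [hsig τ]; simp
    have hcases : (0 < ρ (A 2) ↔ 0 < ρ (A 0)) ∨ (0 < ρ (A 2) ↔ 0 < ρ (A 1)) := by
      simpa [hre] using h2mem
    have hc0' : ρ (c 0) = ρ (A 0) := by simp [c]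
    have hc1' : ρ (c 1) = -(ρ D * ρ (A 0)) := by simp [c]
    have hc2' : ρ (c 2) = ρ (A 1) := by simp [c]
    have hc3' : ρ (c 3) = -(ρ D * ρ (A 1)) := by simp [c]
    have hc4' : ρ (c 4) = -ρ (A 2) := by simp [c]
    rcases hcases with h | h
    · by_cases hp : 0 < ρ (A 0)
      · exact ⟨4, 0, by rw [hc4']; linarith [h.mpr hp], by rw [hc0']; exact hp⟩
      · have hn0 : ρ (A 0) < 0 := lt_of_le_of_ne (not_lt.mp hp) (hρA 0)
        have hn2 : ρ (A 2) < 0 := lt_of_le_of_ne (not_lt.mp fun h2 => hp (h.mp h2)) (hρA 2)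
        exact ⟨0, 4, by rw [hc0']; exact hn0, by rw [hc4']; linarith⟩
    · by_cases hp : 0 < ρ (A 1)
      · exact ⟨4, 2, by rw [hc4']; linarith [h.mpr hp], by rw [hc2']; exact hp⟩
      · have hn1 : ρ (A 1) < 0 := lt_of_le_of_ne (not_lt.mp hp) (hρA 1)
        have hn2 : ρ (A 2) < 0 := lt_of_le_of_ne (not_lt.mp fun h2 => hp (h.mp h2)) (hρA 2)
        exact ⟨2, 4, by rw [hc2']; exact hn1, by rw [hc4']; linarith⟩
  -- a non-trivial zero over `K⁺` (Hasse–Minkowski, O'Meara 66:1 with 63:19)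
  obtain ⟨x, hx0, hx⟩ :=
    diagIsotropic_of_five_le_of_indefinite (maximalRealSubfield K) le_rfl c hc0 hsgn
  have hXfix : ∀ i, IsCMField.complexConj K (x i) = x i := fun i => hfix (x i)
  have e0 : ((c 0 : maximalRealSubfield K) : K) = a 0 := rfl
  have e1 : ((c 1 : maximalRealSubfield K) : K) = -(θ ^ 2 * a 0) := rfl
  have e2 : ((c 2 : maximalRealSubfield K) : K) = a 1 := rfl
  have e3 : ((c 3 : maximalRealSubfield K) : K) = -(θ ^ 2 * a 1) := rfl
  have e4 : ((c 4 : maximalRealSubfield K) : K) = -(a 2) := rfl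
  have hxL : a 0 * (x 0 : K) ^ 2 + -(θ ^ 2 * a 0) * (x 1 : K) ^ 2 + a 1 * (x 2 : K) ^ 2
      + -(θ ^ 2 * a 1) * (x 3 : K) ^ 2 + -(a 2) * (x 4 : K) ^ 2 = 0 := by
    rw [Fin.sum_univ_five] at hx
    have h := congrArg Subtype.val hx
    push_cast at h
    rw [e0, e1, e2, e3, e4] at h
    exact h
  -- `P = X₀ + X₁θ`, `Q = X₂ + X₃θ`, `a₀ N(P) + a₁ N(Q) = a₂ X₄²`
  obtain ⟨P, hP⟩ : ∃ P : K, P = (x 0 : K) + (x 1 : K) * θ := ⟨_, rfl⟩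
  obtain ⟨Q, hQ⟩ : ∃ Q : K, Q = (x 2 : K) + (x 3 : K) * θ := ⟨_, rfl⟩
  have hσP : IsCMField.complexConj K P = (x 0 : K) - (x 1 : K) * θ := by
    rw [hP, map_add, map_mul, hXfix, hXfix, hθ]; ring
  have hσQ : IsCMField.complexConj K Q = (x 2 : K) - (x 3 : K) * θ := by
    rw [hQ, map_add, map_mul, hXfix, hXfix, hθ]; ring
  have key : a 0 * (P * IsCMField.complexConj K P) + a 1 * (Q * IsCMField.complexConj K Q) =
      a 2 * (x 4 : K) ^ 2 := by
    rw [hσP, hσQ, hP, hQ]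
    linear_combination hxL
  by_cases hX4 : (x 4 : K) = 0
  · -- `⟨a₀, a₁⟩` is isotropic, hence universal
    have key0 : a 0 * (P * IsCMField.complexConj K P) + a 1 * (Q * IsCMField.complexConj K Q) =
        0 := by
      rw [key, hX4]; ring
    have hP0 : P ≠ 0 := by
      intro hPz
      have h01 := eq_zero_of_add_mul_skew hθ0 hθ (hXfix 0) (hXfix 1) (hP ▸ hPz)
      have hQz : Q = 0 := by
        have h5 : a 1 * (Q * IsCMField.complexConj K Q) = 0 := by
          rw [hPz, zero_mul, mul_zero, zero_add] at key0; exact key0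
        rcases mul_eq_zero.mp h5 with h6 | h6
        · exact absurd h6 (ha0 1)
        rcases mul_eq_zero.mp h6 with h7 | h7
        · exact h7
        · exact (map_eq_zero (IsCMField.complexConj K)).mp h7
      have h23 := eq_zero_of_add_mul_skew hθ0 hθ (hXfix 2) (hXfix 3) (hQ ▸ hQz)
      apply hx0
      funext i
      fin_cases i
      · exact ZeroMemClass.coe_eq_zero.mp h01.1
      · exact ZeroMemClass.coe_eq_zero.mp h01.2
      · exact ZeroMemClass.coe_eq_zero.mp h23.1
      · exact ZeroMemClass.coe_eq_zero.mp h23.2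
      · exact ZeroMemClass.coe_eq_zero.mp hX4
    have hσP0 : IsCMField.complexConj K P ≠ 0 := fun h =>
      hP0 ((map_eq_zero (IsCMField.complexConj K)).mp h)
    have h4 : (4 : K) ≠ 0 := by norm_num
    have hY : 4 * a 0 * (P * IsCMField.complexConj K P) ≠ 0 :=
      mul_ne_zero (mul_ne_zero h4 (ha0 0)) (mul_ne_zero hP0 hσP0)
    obtain ⟨m, hm⟩ : ∃ m : K, m = a 2 * (4 * a 0 * (P * IsCMField.complexConj K P))⁻¹ :=
      ⟨_, rfl⟩
    have hm' : m * (4 * a 0 * (P * IsCMField.complexConj K P)) = a 2 := by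
      rw [hm, mul_assoc, inv_mul_cancel₀ hY, mul_one]
    have hmfix : IsCMField.complexConj K m = m := by
      rw [hm]
      simp only [map_mul, map_inv₀, map_ofNat, ha, IsCMField.complexConj_apply_apply]
      ring
    refine ⟨P * (1 + m), Q * (1 - m), ?_⟩
    rw [map_mul, map_mul, map_add, map_sub, map_one, hmfix]
    linear_combination (1 - m) ^ 2 * key0 + hm'
  · -- divide by `X₄`
    obtain ⟨u, hu⟩ : ∃ u : K, u = ((x 4 : K))⁻¹ := ⟨_, rfl⟩
    have hu1 : u * (x 4 : K) = 1 := by rw [hu]; exact inv_mul_cancel₀ hX4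
    have hufix : IsCMField.complexConj K u = u := by rw [hu, map_inv₀, hXfix]
    refine ⟨P * u, Q * u, ?_⟩
    rw [map_mul, map_mul, hufix]
    linear_combination u ^ 2 * key + a 2 * (u * (x 4 : K) + 1) * hu1

variable {K} in
/-- **Step 2 (pure algebra).** If `⟨a₀, a₁⟩` represents `a₂` (`a₀ N(p) + a₁ N(q) = a₂`) and the
discriminants agree (`a₀a₁ = a₂a₃ N(z)`, `z ≠ 0`), then `g = [[p, a₁ σ(q) w], [q, -a₀ σ(p) w]]`,
`w = (a₂z)⁻¹`, is an isometry `⟨a₀, a₁⟩ ≅ ⟨a₂, a₃⟩`: `ᵗ(σ g) · diag(a₀, a₁) · g = diag(a₂, a₃)`.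
[folklore] -/
theorem isometry_of_rep (a : Fin 4 → K) (ha : ∀ i, IsCMField.complexConj K (a i) = a i)
    (ha0 : ∀ i, a i ≠ 0) (z : K) (hz0 : z ≠ 0)
    (hz : a 0 * a 1 = a 2 * a 3 * (z * IsCMField.complexConj K z)) (p q : K)
    (hrep : a 0 * (p * IsCMField.complexConj K p) + a 1 * (q * IsCMField.complexConj K q) = a 2) :
    ∃ g : GL (Fin 2) K,
      ((g : Matrix (Fin 2) (Fin 2) K).transpose.map (IsCMField.complexConj K)) *
          Matrix.diagonal ![a 0, a 1] * (g : Matrix (Fin 2) (Fin 2) K) =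
        Matrix.diagonal ![a 2, a 3] := by
  obtain ⟨w, hw⟩ : ∃ w : K, w = (a 2 * z)⁻¹ := ⟨_, rfl⟩
  have hw1 : w * (a 2 * z) = 1 := by rw [hw]; exact inv_mul_cancel₀ (mul_ne_zero (ha0 2) hz0)
  have hw1' : IsCMField.complexConj K w * (a 2 * IsCMField.complexConj K z) = 1 := by
    have h := congrArg (IsCMField.complexConj K) hw1
    rwa [map_mul, map_mul, ha, map_one] at h
  have hw0 : w ≠ 0 := fun h => by rw [h, zero_mul] at hw1; exact zero_ne_one hw1
  let G : Matrix (Fin 2) (Fin 2) K :=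
    !![p, a 1 * IsCMField.complexConj K q * w; q, -(a 0 * IsCMField.complexConj K p * w)]
  have hdet : G.det ≠ 0 := by
    have hd : G.det = -(w * a 2) := by
      rw [Matrix.det_fin_two_of]
      linear_combination (-w) * hrep
    rw [hd]
    exact neg_ne_zero.mpr (mul_ne_zero hw0 (ha0 2))
  refine ⟨Matrix.GeneralLinearGroup.mkOfDetNeZero G hdet, ?_⟩
  rw [Matrix.GeneralLinearGroup.val_mkOfDetNeZero]
  ext i j
  fin_cases i <;> fin_cases j <;>
    simp [G, Matrix.mul_apply, Fin.sum_univ_two, Matrix.diagonal, map_mul, map_neg, ha,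
      IsCMField.complexConj_apply_apply]
  · linear_combination hrep
  · ring
  · ring
  · linear_combination (a 0 * a 1 * w * IsCMField.complexConj K w) * hrep
      + (w * IsCMField.complexConj K w * a 2) * hz
      + (a 3 * (IsCMField.complexConj K w * (a 2 * IsCMField.complexConj K z))) * hw1
      + a 3 * hw1'

end Landherr

/-- **Landherr's theorem for hermitian planes over a CM field, sufficiency of the invariants**
(Landherr 1936; Scharlau Ch. 10; Deligne LNM 900 Prop. 4.1; Cattani et al. Thm. 11.5.13 — the
case of rank `2` in coordinates). Let `K` be a CM field with complex conjugation `σ` and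
`a₀, a₁, a₂, a₃ ∈ K` be non-zero and `σ`-fixed (i.e. in `K⁺ˣ`). If the diagonal hermitian planes
`⟨a₀, a₁⟩` and `⟨a₂, a₃⟩` have the same signs at every complex embedding `τ` of `K` (equal
signatures) and `a₀a₁ = a₂a₃ · N(z)` for some `z ∈ Kˣ` (equal discriminants in `K⁺ˣ/N(Kˣ)`),
then they are isometric: `ᵗ(σ g) · diag(a₀, a₁) · g = diag(a₂, a₃)` for some `g ∈ GL₂(K)`.
Proof: `Landherr.exists_rep_of_signs` (Hasse–Minkowski over `K⁺`) and `Landherr.isometry_of_rep`.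
[cite: Landherr1936HermitianForms] -/
theorem hermitianPlanes_isometric_of_invariants (K : Type) [Field K] [NumberField K] [IsCMField K]
    (a : Fin 4 → K) (ha : ∀ i, IsCMField.complexConj K (a i) = a i) (ha0 : ∀ i, a i ≠ 0)
    (hsig : ∀ τ : K →+* ℂ,
      ({decide (0 < (τ (a 0)).re), decide (0 < (τ (a 1)).re)} : Multiset Bool) =
        {decide (0 < (τ (a 2)).re), decide (0 < (τ (a 3)).re)})
    (hdisc : ∃ z : K, z ≠ 0 ∧ a 0 * a 1 = a 2 * a 3 * (z * IsCMField.complexConj K z)) :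
    ∃ g : GL (Fin 2) K,
      ((g : Matrix (Fin 2) (Fin 2) K).transpose.map (IsCMField.complexConj K)) *
          Matrix.diagonal ![a 0, a 1] * (g : Matrix (Fin 2) (Fin 2) K) =
        Matrix.diagonal ![a 2, a 3] := by
  obtain ⟨z, hz0, hz⟩ := hdisc
  obtain ⟨p, q, hrep⟩ := Landherr.exists_rep_of_signs K a ha ha0 hsig
  exact Landherr.isometry_of_rep a ha ha0 z hz0 hz p q hrep

end Literature.NumberTheory.QuadraticForms

end
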